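import Summits.BirchSwinnertonDyer.Rank1Residual.GaloisImage.KuriharaRecordBSDpThree
import Summits.BirchSwinnertonDyer.Rank1Residual.Additive.X4ThreeKolyvaginLevelCertificates
import Summits.BirchSwinnertonDyer.Rank1Residual.Additive.X4ThreeKuriharaCertRecords1Tamagawa
import Summits.BirchSwinnertonDyer.Rank1Residual.GaloisImage.LocalThreeTorsionRecords
import Literature.NumberTheory.EllipticCurves.AtkinLehnerFrickeLevelProofs
import Summits.BirchSwinnertonDyer.Rank1Residual.Additive.IntModelConductorCertificate
import HarnessLib

/-!
# N11 LOWER@3 — the FIRST ROUTE-1 PILOT RECORD: `BSD(E,3)` for `22077e1` at its printed Kolyvagin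
# level `139·151 = 20989` WITHOUT the [K25] preprint — through p18's record-ready END corollary
# (ROUTE-1 sub-route (a′), R1-45 (e) / R1-46 S-B1 sentinel A1)
# (cell `b2b-bsdres`, team n1011, seat p03 gen 6, row T-a2-REC kernel-node lane; consumers of
# `GaloisImage/KuriharaRecordBSDpThree` (p18), `Additive/X4ThreeKolyvaginLevelCertificates` (p03),
# `Additive/X4ThreeKuriharaCertRecords1{,Tamagawa}` (p03))

HONEST FRAMING (cell `b2b-bsdres`, run/shared/lean/b2b/bsd-rank1-residual/, verbatim in every
file): the goal of the cell is to DELETE the COMBINATION-SHAPED residual classes of the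
Birch–Swinnerton-Dyer formula for ALL analytic-rank `≤ 1` elliptic curves over `ℚ` — "full BSD
formula for every rank `≤ 1` curve in class `C`" assembled STRICTLY from published theorems — so
that the rank-`≤ 1` remainder becomes exactly the CONSTRUCTION-SHAPED classes, which are TYPED
(missing-input `Prop`s), NOT attempted. This is not "finishing BSD". Team n1011 is a RESEARCH ROUTE;
no claim beyond the stated classes; the label X4 and the mark of RESIDUAL-MAP §I N11 (LOWER@3) are
UNCHANGED; a PER-PAIR record, not a class theorem; an EVIDENCE-grade booking CANDIDATE for the
director, nothing is booked by this file. Theorems only (no definition, no named fact).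

## What this file does

The [K25]-conditional record `bsdp3_kur_v22077e1` (Records 1, p258718: `hK25s`, FLAG
`Kim2025-preprint`) gets a ROUTE-1 twin **`bsdp3_route1_v22077e1`** in which the ANNOUNCED preprint is
REPLACED by published-at-`3` inputs and ONE typed PORT, exactly as p18's
`Assembly.bsdp_three_of_towerSurj_of_kolyvaginProduct` (`GaloisImage/KuriharaRecordBSDpThree`, row
T-R1-45 FILE E2) offers: CONDITIONAL on the named facts `hS24` / `hS24₂` ([Sakamoto2024] Thm. 4.4
(1)(2)), the Poitou–Tate families `inv` / `inv'` with their perfectness / sum / complement /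
injectivity, Tate's `hEP`, the ONE port `KatoKuriharaPortThreeAt W 0 v₃` (FLAG `K22-Thm3.13-PORT@3`,
the DICT3 debt line), and — for the UPPER half — the five named facts of the X4 chain of record
(`hKatoS hDel hmodD hL20 hKatoχ`) with `hGZK`, `hmod`, `h26`.

IN THE KERNEL for this pair (by name, nothing restated): the integer model, `3 ∣ Δ`, `3 ∣ c₄`
(ADDITIVE at `3`), the `3`-adic tower (`towerSurj3_v22077e1`, Records 1), `∏ c_ℓ = 2`
(`tamagawaProduct_v22077e1`, Records 1 Tamagawa), the LEVEL `20989 = 139·151 ∈ 𝒩₁(E,3)`, cyclicity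
at both primes and `ℓ ∤ 22077` (`isKolyvaginProduct_one_v22077e1`, `forall_card_torsion_le_v22077e1`,
`forall_not_dvd_level_v22077e1`, p284347).  `#E(ℚ₃)[3] = 1` (class A1, `t = 0`: p17's kernel decider instance
`LocalTorsion3.natCard_threeTorsion_22077e1`, T-LOC3T C3 p285951).  EVIDENCE binders per pair: `hr : r_an = 0`,
the OPTIMAL datum `D`/`hopt` at level `22077 ≤ 130000`, the Kurihara VALUE `hδ` (`∃ ψ` surjective
with `δ̃_{20989}(ψ) ≢ 0 (mod 3)` — [K25] App. §8.1.1 PRINT × p08 engine 2 j122130 × KURX j121455, the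
two-source certificate of Records 1) and the VANISHING of the two single-prime Kurihara numbers
`hv` (`δ̃_{139} = δ̃_{151} = 0`; engine EVIDENCE — or a THEOREM by parity once the rank-0 Fricke sign
`w_N f = −f` is supplied: p18's `…_of_pair`, p03's T-R1-55 `atkinLehnerInvolution_level_eq_neg_of_entireLFunction_one_ne_zero`;
the parity twin **`bsdp3_route1_v22077e1_of_conductor`** is in this file: its only certificate binder is the VALUE,
its extra binder `hNE : W.conductorNorm ℤ = 22077` (Cremona)).

Nothing is booked; the port, the PT families, `hEP`, [S24] and the UPPER-half facts are NOT
discharged here; X4 stays CONSTRUCTION-SHAPED.  r1 ROUTE-1 §29.5 (R1-46): "the first record through B1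
is a pure computation once B1-asm lands" — this is that computation for the A1 sentinel.

References: [Kim2022StructureSelmer] Thm. 1.9 (6), §1.2.2; [Sakamoto2024] Thm. 4.4; [Kato2004Asterisque]
Thm. 14.5 (3); [Delbourgo1998] Prop. 4; [Wuthrich2014] Lemma 20; [AgasheRibetStein2006] Thm. 2.6;
[Miller2011LMS] Def. 1.1; [CremonaAlgorithms1997] Table 1; [Kim2025RefinedTNC] App. §8.1.1 (the
printed pair — EVIDENCE provenance only, no longer an input).
-/

set_option autoImplicit false

noncomputable section

open scoped Classical NumberField

open Function NumberField IsDedekindDomain WeierstrassCurve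
  Literature.NumberTheory.EllipticCurves Literature.NumberTheory.EllipticCurves.ModularForms
  Literature.NumberTheory.EllipticCurves.Rank1Residual
  Literature.NumberTheory.EllipticCurves.AgasheRibetStein2006
  Literature.NumberTheory.GaloisRepresentations
  Literature.NumberTheory.GaloisRepresentations.DiscreteGaloisModule Literature.NumberTheory.GaloisCohomology
  IsDedekindDomain.HeightOneSpectrum Rat.HeightOneSpectrum
  Summit.BirchSwinnertonDyer.Rank1Residual.GaloisImage Summit.BirchSwinnertonDyer.Rank1Residual.X4

namespace Summit.BirchSwinnertonDyer.Rank1Residual.Additive.X4ThreeKuriharaCert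

/-- **ROUTE-1 PILOT RECORD: `BSD(E,3)` for `22077e1` at the level `n = 139·151 = 20989`, [K25]-FREE**
— for any globally minimal elliptic `W/ℚ` with Cremona's integral model
`[0, 0, 1, -5376115974, -151721379981842]` (`N = 22077 = 3²·11·223`, ADDITIVE at `3`, potentially good,
`∏ c_ℓ = 2`, `#Ш_an = 81`): p18's `Assembly.bsdp_three_of_towerSurj_of_kolyvaginProduct` with the
curve-side inputs BY NAME from the kernel (`3 ∣ Δ`, `3 ∣ c₄`, tower, `3 ∤ ∏c`, `20989 ∈ 𝒩₁`, cyclicity,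
`ℓ ∤ 22077`, `#E(ℚ₃)[3] = 1`), the per-pair EVIDENCE binders `hr`, `D`/`hopt`, `hδ` (the VALUE and the two
single-prime vanishings)), and the NAMED typed inputs {`hS24`, `hS24₂`, `inv…`, `inv'…`, `hEP`, `hPort`}
∪ {`hKatoS`, `hDel`, `hmodD`, `hL20`, `hKatoχ`, `hGZK`, `hmod`, `h26`}.  CERTIFICATE-EVIDENCE; nothing
booked; no mark moved; replaces NO [K25]-record (it is its Route-1 twin).
[cite: Kim2022StructureSelmer, Thm. 1.9 (6), §1.2.2] [cite: Sakamoto2024, Thm. 4.4 (p. 926)]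
[cite: Kato2004Asterisque, Thm. 14.5 (3) (p. 236)] [cite: AgasheRibetStein2006, Thm. 2.6 (p. 619)]
[cite: Miller2011LMS, §1 and Def. 1.1] [cite: CremonaAlgorithms1997, Table 1] -/
theorem bsdp3_route1_v22077e1
    -- UPPER half: the X4 chain of record
    (hKatoS : Kato2004.rankZero_padicValNat_sha_le_sub_localTamagawa_of_additive_potGood_of_imageContainsSL2)
    (hDel : Delbourgo1998.prop4_rankZero_pow_dvd_constantCoeff)
    (hGZK : rank_eq_analyticRank_of_analyticRank_le_one) (hmod : hasEntireLFunction_rat)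
    (hmodD : nonempty_modularParametrizationData)
    (hL20 : Wuthrich2014.lemma20_surjective_threeAdic_of_semistable)
    (hKatoχ : Wuthrich2014.kato_halfEigenCharIdeal_dvd_cyclotomicPrime_of_surjective)
    (h26 : cremona_abs_maninConstant_eq_one_of_level_le)
    -- LOWER half: [S24] (1)(2)
    (hS24 : Sakamoto2024.kolyvaginSystems_freeRankOne_zmod_three_pow)
    (hS24₂ : Sakamoto2024.kolyvaginSystems_idealOfBasis_eq_fittingIdeal_zmod_three_pow)
    -- the pair
    {W : WeierstrassCurve ℚ} [W.IsElliptic] [W.IsGloballyMinimal]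
    (hI : integralModelInt W = ⟨0, 0, 1, -5376115974, -151721379981842⟩)
    (hr : W.analyticRank = 0)
    (D : ModularParametrizationData W 22077)
    (hopt : ∀ z ∈ D.L.lattice, ∃ w ∈ periodLattice D.f, z = D.c * w)
    -- LOWER half: Poitou–Tate families, Tate's local Euler characteristic, the ONE port
    (inv : LocalInvariants ℚ 3) (hperf : inv.IsPerfect) (hsum : inv.SumLocalTermEqZero)
    (hcompl : inv.SelmerComplement)
    (inv' : ∀ k' : ℕ, LocalInvariants ℚ (3 ^ (k' + 1))) (hperf' : ∀ k', (inv' k').IsPerfect)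
    (hsum' : ∀ k', (inv' k').SumLocalTermEqZero) (hcompl' : ∀ k', (inv' k').SelmerComplement)
    (hinj' : ∀ k', ∀ v : HeightOneSpectrum (𝓞 ℚ), Injective (inv' k' (Sum.inr v)))
    (hEP : ∀ v : HeightOneSpectrum (𝓞 ℚ), localEulerPoincareCharacteristic (v.adicCompletion ℚ))
    (v₃ : HeightOneSpectrum (𝓞 ℚ)) (hv₃ : ((3 : ℕ) : 𝓞 ℚ) ∈ v₃.asIdeal)
    (hPort : KatoKuriharaPortThreeAt W 0 v₃)
    -- the CERTIFICATE at the level `20989`: VALUE (EVIDENCE) and the two single-prime vanishings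
    (hδ : ∃ ψ : (ℓ : ℕ) → (ZMod ℓ)ˣ →* Multiplicative (ZMod (3 ^ 1)),
      (∀ ℓ ∈ (20989 : ℕ).primeFactors, Function.Surjective (ψ ℓ)) ∧
        kuriharaNumber D.f (3 ^ 1) 20989 ψ ≠ 0 ∧
        ∀ d : ℕ, d ∣ 20989 → 1 < d → d < 20989 → ∀ [NeZero d], kuriharaNumber D.f (3 ^ 1) d ψ = 0) :
    haveI : Fact (Nat.Prime 3) := ⟨Nat.prime_three⟩
    BSDp W 3 := by
  haveI : Fact (Nat.Prime 3) := ⟨Nat.prime_three⟩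
  obtain ⟨ψ, hψ, hcert, hv⟩ := hδ
  haveI : NeZero (20989 : ℕ) := ⟨by norm_num⟩
  exact Assembly.bsdp_three_of_towerSurj_of_kolyvaginProduct hKatoS hDel hGZK hmod hmodD hL20 hKatoχ h26
    hS24 hS24₂ W hI (by decide +kernel) (by decide +kernel) (towerSurj3_v22077e1 hI)
    ((LocalTorsion3.natCard_threeTorsion_22077e1 W hI).trans (pow_zero 3)) hr
    (by rw [tamagawaProduct_v22077e1 hI]; decide) (by norm_num) D hopt inv hperf hsum hcompl inv' hperf'
    hsum' hcompl' hinj' hEP v₃ hv₃ hPort 20989 (isKolyvaginProduct_one_v22077e1 hI)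
    (forall_card_torsion_le_v22077e1 hI) forall_not_dvd_level_v22077e1 ψ hψ hcert hv

/-- **The same for any `W` EQUAL to the literal Cremona model** `[0, 0, 1, -5376115974, -151721379981842]`
(instances supplied by the caller, e.g. `X11b.isElliptic_of_discOf_ne_zero` / Kraus as in Records 1).
[cite: Kim2022StructureSelmer, Thm. 1.9 (6)] [cite: Sakamoto2024, Thm. 4.4 (p. 926)] [cite: CremonaAlgorithms1997, Table 1] -/
theorem bsdp3_route1_v22077e1_of_eq
    (hKatoS : Kato2004.rankZero_padicValNat_sha_le_sub_localTamagawa_of_additive_potGood_of_imageContainsSL2)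
    (hDel : Delbourgo1998.prop4_rankZero_pow_dvd_constantCoeff)
    (hGZK : rank_eq_analyticRank_of_analyticRank_le_one) (hmod : hasEntireLFunction_rat)
    (hmodD : nonempty_modularParametrizationData)
    (hL20 : Wuthrich2014.lemma20_surjective_threeAdic_of_semistable)
    (hKatoχ : Wuthrich2014.kato_halfEigenCharIdeal_dvd_cyclotomicPrime_of_surjective)
    (h26 : cremona_abs_maninConstant_eq_one_of_level_le)
    (hS24 : Sakamoto2024.kolyvaginSystems_freeRankOne_zmod_three_pow)
    (hS24₂ : Sakamoto2024.kolyvaginSystems_idealOfBasis_eq_fittingIdeal_zmod_three_pow)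
    (W : WeierstrassCurve ℚ) [W.IsElliptic] [W.IsGloballyMinimal]
    (hW : W = ⟨0, 0, 1, -5376115974, -151721379981842⟩)
    (hr : W.analyticRank = 0)
    (D : ModularParametrizationData W 22077)
    (hopt : ∀ z ∈ D.L.lattice, ∃ w ∈ periodLattice D.f, z = D.c * w)
    (inv : LocalInvariants ℚ 3) (hperf : inv.IsPerfect) (hsum : inv.SumLocalTermEqZero)
    (hcompl : inv.SelmerComplement)
    (inv' : ∀ k' : ℕ, LocalInvariants ℚ (3 ^ (k' + 1))) (hperf' : ∀ k', (inv' k').IsPerfect)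
    (hsum' : ∀ k', (inv' k').SumLocalTermEqZero) (hcompl' : ∀ k', (inv' k').SelmerComplement)
    (hinj' : ∀ k', ∀ v : HeightOneSpectrum (𝓞 ℚ), Injective (inv' k' (Sum.inr v)))
    (hEP : ∀ v : HeightOneSpectrum (𝓞 ℚ), localEulerPoincareCharacteristic (v.adicCompletion ℚ))
    (v₃ : HeightOneSpectrum (𝓞 ℚ)) (hv₃ : ((3 : ℕ) : 𝓞 ℚ) ∈ v₃.asIdeal)
    (hPort : KatoKuriharaPortThreeAt W 0 v₃)
    (hδ : ∃ ψ : (ℓ : ℕ) → (ZMod ℓ)ˣ →* Multiplicative (ZMod (3 ^ 1)),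
      (∀ ℓ ∈ (20989 : ℕ).primeFactors, Function.Surjective (ψ ℓ)) ∧
        kuriharaNumber D.f (3 ^ 1) 20989 ψ ≠ 0 ∧
        ∀ d : ℕ, d ∣ 20989 → 1 < d → d < 20989 → ∀ [NeZero d], kuriharaNumber D.f (3 ^ 1) d ψ = 0) :
    haveI : Fact (Nat.Prime 3) := ⟨Nat.prime_three⟩
    BSDp W 3 := by
  have hI : integralModelInt W = ⟨0, 0, 1, -5376115974, -151721379981842⟩ := by
    subst hW
    exact Summit.BirchSwinnertonDyer.BirchSwinnertonDyer.Rank1Residual.IntModel.integralModelInt_eq_of_map_eq _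
      (Summit.BirchSwinnertonDyer.BirchSwinnertonDyer.Rank1Residual.IntModel.map_mk_int 0 0 1
        (-5376115974) (-151721379981842))
  exact bsdp3_route1_v22077e1 hKatoS hDel hGZK hmod hmodD hL20 hKatoχ h26 hS24 hS24₂ hI hr D hopt
    inv hperf hsum hcompl inv' hperf' hsum' hcompl' hinj' hEP v₃ hv₃ hPort hδ

/-- **The rank-0 Fricke sign at any level equal to the conductor** (transport of p03's T-R1-55
`atkinLehnerInvolution_level_eq_neg_of_entireLFunction_one_ne_zero` along `W.conductorNorm ℤ = N`):
for the newform `f` of `W` at level `N = N_E` with `L(E,1) ≠ 0`, `w_{Q=N} f = −f`. [cite: AtkinLehner1970, Thm. 3]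
[cite: Knapp1993, Lemma 9.24 and Thm. 9.27] -/
theorem atkinLehnerInvolution_eq_neg_of_conductorNorm_eq {W : WeierstrassCurve ℚ} [W.IsElliptic]
    {N : ℕ} [NeZero N] (hNE : W.conductorNorm ℤ = N) (f : CuspForm (CongruenceSubgroup.Gamma0 N) 2)
    (hf : IsNewformOf W f) (hL : W.entireLFunction 1 ≠ 0) :
    atkinLehnerInvolution N 2 N f = -f := by
  subst hNE
  rw [atkinLehnerInvolution_level_eq_neg_of_entireLFunction_one_ne_zero hf hL, neg_one_smul]

/-- `20989 = 139·151` has exactly two prime factors. [folklore] -/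
private theorem card_primeFactors_20989 : (20989 : ℕ).primeFactors.card = 2 := by
  rw [show (20989 : ℕ) = 139 * 151 by norm_num, Nat.primeFactors_mul (by norm_num) (by norm_num),
    Nat.Prime.primeFactors (by norm_num), Nat.Prime.primeFactors (by norm_num)]
  decide

/-- **ROUTE-1 PILOT RECORD, PARITY FORM: `BSD(E,3)` for `22077e1` at `20989` with the single-prime
vanishings DISCHARGED** — p18's `Assembly.exists_LOmega_padicValRat_le_of_towerSurj_of_pair` (E1,
ν(n) = 2: the vanishing of `δ̃_{139}`, `δ̃_{151}` by additive-p4's parity lemma from the rank-0 Fricke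
sign) with the Fricke sign `w_N f = −f` a THEOREM (p03 T-R1-55, from `L(E,1) ≠ 0` ⟸ `r_an = 0` and
`D.isNewformOf`) and ONE extra binder `hNE : W.conductorNorm ℤ = 22077` (Cremona's conductor; a kernel
conductor certificate would discharge it), then additive-p4's socket
`X4RankZero.bsdp_three_of_towerSurj_of_optimal_of_LOmegaWitness` as in E2.  The certificate binder is
now ONLY the VALUE `δ̃_{20989}(ψ) ≢ 0 (mod 3)` (EVIDENCE: print × engine 2 × KURX).  CERTIFICATE-EVIDENCE;
nothing booked; no mark moved. [cite: Kim2022StructureSelmer, Thm. 1.9 (6), §1.2.2]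
[cite: Sakamoto2024, Thm. 4.4 (p. 926)] [cite: Kato2004Asterisque, Thm. 14.5 (3) (p. 236)]
[cite: AgasheRibetStein2006, Thm. 2.6 (p. 619)] [cite: AtkinLehner1970, Thm. 3] [cite: CremonaAlgorithms1997, Table 1] -/
theorem bsdp3_route1_v22077e1_of_conductor
    (hKatoS : Kato2004.rankZero_padicValNat_sha_le_sub_localTamagawa_of_additive_potGood_of_imageContainsSL2)
    (hDel : Delbourgo1998.prop4_rankZero_pow_dvd_constantCoeff)
    (hGZK : rank_eq_analyticRank_of_analyticRank_le_one) (hmod : hasEntireLFunction_rat)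
    (hmodD : nonempty_modularParametrizationData)
    (hL20 : Wuthrich2014.lemma20_surjective_threeAdic_of_semistable)
    (hKatoχ : Wuthrich2014.kato_halfEigenCharIdeal_dvd_cyclotomicPrime_of_surjective)
    (h26 : cremona_abs_maninConstant_eq_one_of_level_le)
    (hS24 : Sakamoto2024.kolyvaginSystems_freeRankOne_zmod_three_pow)
    (hS24₂ : Sakamoto2024.kolyvaginSystems_idealOfBasis_eq_fittingIdeal_zmod_three_pow)
    {W : WeierstrassCurve ℚ} [W.IsElliptic] [W.IsGloballyMinimal]
    (hI : integralModelInt W = ⟨0, 0, 1, -5376115974, -151721379981842⟩)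
    (hNE : W.conductorNorm ℤ = 22077) (hr : W.analyticRank = 0)
    (D : ModularParametrizationData W 22077)
    (hopt : ∀ z ∈ D.L.lattice, ∃ w ∈ periodLattice D.f, z = D.c * w)
    (inv : LocalInvariants ℚ 3) (hperf : inv.IsPerfect) (hsum : inv.SumLocalTermEqZero)
    (hcompl : inv.SelmerComplement)
    (inv' : ∀ k' : ℕ, LocalInvariants ℚ (3 ^ (k' + 1))) (hperf' : ∀ k', (inv' k').IsPerfect)
    (hsum' : ∀ k', (inv' k').SumLocalTermEqZero) (hcompl' : ∀ k', (inv' k').SelmerComplement)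
    (hinj' : ∀ k', ∀ v : HeightOneSpectrum (𝓞 ℚ), Injective (inv' k' (Sum.inr v)))
    (hEP : ∀ v : HeightOneSpectrum (𝓞 ℚ), localEulerPoincareCharacteristic (v.adicCompletion ℚ))
    (v₃ : HeightOneSpectrum (𝓞 ℚ)) (hv₃ : ((3 : ℕ) : 𝓞 ℚ) ∈ v₃.asIdeal)
    (hPort : KatoKuriharaPortThreeAt W 0 v₃)
    (hδ : ∃ ψ : (ℓ : ℕ) → (ZMod ℓ)ˣ →* Multiplicative (ZMod (3 ^ 1)),
      (∀ ℓ ∈ (20989 : ℕ).primeFactors, Function.Surjective (ψ ℓ)) ∧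
        kuriharaNumber D.f (3 ^ 1) 20989 ψ ≠ 0) :
    haveI : Fact (Nat.Prime 3) := ⟨Nat.prime_three⟩
    BSDp W 3 := by
  haveI : Fact (Nat.Prime 3) := ⟨Nat.prime_three⟩
  haveI : NeZero (20989 : ℕ) := ⟨by norm_num⟩
  obtain ⟨ψ, hψ, hcert⟩ := hδ
  have hadd : Addv W 3 := addv_of_intModel hI 3 (by decide +kernel) (by decide +kernel)
  have htam : ¬ 3 ∣ W.tamagawaProduct := by rw [tamagawaProduct_v22077e1 hI]; decide
  have hc3 : ¬ 3 ∣ (W.baseChange ℚ_[3]).localTamagawaNumber ℤ_[3] := fun h =>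
    htam (h.trans (localTamagawaNumber_padic_dvd_tamagawaProduct W 3))
  have htower : ∀ m : ℕ, W.HasSurjectiveModNGaloisRep (3 ^ m : ℕ) := towerSurj3_v22077e1 hI
  have hsurj : W.HasSurjectiveModNGaloisRep 3 := by simpa using htower 1
  have ht0 : Nat.card {Q : (W.baseChange ℚ_[3]).toAffine.Point // (3 : ℕ) • Q = 0} = 1 :=
    (LocalTorsion3.natCard_threeTorsion_22077e1 W hI).trans (pow_zero 3)
  have hL : W.entireLFunction 1 ≠ 0 := (W.analyticRank_eq_zero_iff_holds (hmod W)).mp hr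
  have hε : atkinLehnerInvolution 22077 2 22077 D.f = -D.f :=
    atkinLehnerInvolution_eq_neg_of_conductorNorm_eq hNE D.f D.isNewformOf hL
  obtain ⟨q₀, hq₀, hw⟩ := Assembly.exists_LOmega_padicValRat_le_of_towerSurj_of_pair hS24 hS24₂ hGZK
    hmod h26 W hadd hc3 htower ht0 hr (by norm_num) D hopt hNE hε inv hperf hsum hcompl inv' hperf'
    hsum' hcompl' hinj' hEP v₃ hv₃ hPort 20989 (isKolyvaginProduct_one_v22077e1 hI)
    card_primeFactors_20989 (forall_card_torsion_le_v22077e1 hI) ψ hψ hcert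
  exact X4RankZero.bsdp_three_of_towerSurj_of_optimal_of_LOmegaWitness W hKatoS hDel hGZK hmod hmodD
    hL20 hKatoχ h26 hadd hsurj htower hr htam (by norm_num) ⟨D, hopt⟩ hq₀ hw

/-- **ROUTE-1 PILOT RECORD, PARITY FORM, CONDUCTOR CERTIFIED: `BSD(E,3)` for `22077e1` at `20989`** —
`bsdp3_route1_v22077e1_of_conductor` with its binder `hNE : W.conductorNorm ℤ = 22077` DISCHARGED by
p18's kernel conductor certificate `IntModelCond.conductorNorm_22077e1` (row T-NCOND: the Rank-2
observatory's `conductorNorm_eq_conductorLocal23` engine — Tate at `11, 223`, Kraus / Papadopoulos at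
`2, 3` — run on the globally minimal model `integralModelInt W`; no named fact).  After this re-thread
the parity twin's ONLY evidence binder is the VALUE `δ̃_{20989}(ψ) ≢ 0 (mod 3)` (EVIDENCE: print ×
engine 2 × KURX); the named-fact hypotheses are the (M) / E1 sockets', unchanged.  CERTIFICATE-EVIDENCE;
nothing booked; no mark moved. [cite: Kim2022StructureSelmer, Thm. 1.9 (6), §1.2.2]
[cite: Sakamoto2024, Thm. 4.4 (p. 926)] [cite: Kato2004Asterisque, Thm. 14.5 (3) (p. 236)]
[cite: AgasheRibetStein2006, Thm. 2.6 (p. 619)] [cite: AtkinLehner1970, Thm. 3] [cite: CremonaAlgorithms1997, Table 1] -/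
theorem bsdp3_route1_v22077e1_of_conductorCert
    (hKatoS : Kato2004.rankZero_padicValNat_sha_le_sub_localTamagawa_of_additive_potGood_of_imageContainsSL2)
    (hDel : Delbourgo1998.prop4_rankZero_pow_dvd_constantCoeff)
    (hGZK : rank_eq_analyticRank_of_analyticRank_le_one) (hmod : hasEntireLFunction_rat)
    (hmodD : nonempty_modularParametrizationData)
    (hL20 : Wuthrich2014.lemma20_surjective_threeAdic_of_semistable)
    (hKatoχ : Wuthrich2014.kato_halfEigenCharIdeal_dvd_cyclotomicPrime_of_surjective)
    (h26 : cremona_abs_maninConstant_eq_one_of_level_le)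
    (hS24 : Sakamoto2024.kolyvaginSystems_freeRankOne_zmod_three_pow)
    (hS24₂ : Sakamoto2024.kolyvaginSystems_idealOfBasis_eq_fittingIdeal_zmod_three_pow)
    {W : WeierstrassCurve ℚ} [W.IsElliptic] [W.IsGloballyMinimal]
    (hI : integralModelInt W = ⟨0, 0, 1, -5376115974, -151721379981842⟩)
    (hr : W.analyticRank = 0)
    (D : ModularParametrizationData W 22077)
    (hopt : ∀ z ∈ D.L.lattice, ∃ w ∈ periodLattice D.f, z = D.c * w)
    (inv : LocalInvariants ℚ 3) (hperf : inv.IsPerfect) (hsum : inv.SumLocalTermEqZero)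
    (hcompl : inv.SelmerComplement)
    (inv' : ∀ k' : ℕ, LocalInvariants ℚ (3 ^ (k' + 1))) (hperf' : ∀ k', (inv' k').IsPerfect)
    (hsum' : ∀ k', (inv' k').SumLocalTermEqZero) (hcompl' : ∀ k', (inv' k').SelmerComplement)
    (hinj' : ∀ k', ∀ v : HeightOneSpectrum (𝓞 ℚ), Injective (inv' k' (Sum.inr v)))
    (hEP : ∀ v : HeightOneSpectrum (𝓞 ℚ), localEulerPoincareCharacteristic (v.adicCompletion ℚ))
    (v₃ : HeightOneSpectrum (𝓞 ℚ)) (hv₃ : ((3 : ℕ) : 𝓞 ℚ) ∈ v₃.asIdeal)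
    (hPort : KatoKuriharaPortThreeAt W 0 v₃)
    (hδ : ∃ ψ : (ℓ : ℕ) → (ZMod ℓ)ˣ →* Multiplicative (ZMod (3 ^ 1)),
      (∀ ℓ ∈ (20989 : ℕ).primeFactors, Function.Surjective (ψ ℓ)) ∧
        kuriharaNumber D.f (3 ^ 1) 20989 ψ ≠ 0) :
    haveI : Fact (Nat.Prime 3) := ⟨Nat.prime_three⟩
    BSDp W 3 :=
  bsdp3_route1_v22077e1_of_conductor hKatoS hDel hGZK hmod hmodD hL20 hKatoχ h26 hS24 hS24₂ hI
    (IntModelCond.conductorNorm_22077e1 W hI) hr D hopt inv hperf hsum hcompl inv' hperf' hsum' hcompl'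
    hinj' hEP v₃ hv₃ hPort hδ

end Summit.BirchSwinnertonDyer.Rank1Residual.Additive.X4ThreeKuriharaCert

end
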